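import Literature.NumberTheory.Rogawski1990.UnitaryCartanClassesFinite          -- ★ (B7a) p851679 `exists_finset_cartanSubgroups_of_types_of_norms` (this lineage, g24)
import Literature.NumberTheory.Rogawski1990.CartanNormClassesFinite             -- (B7a′) p851686 `exists_finset_norm_classes` (this lineage, g24; over ★ (B6) p851678 F0P2-p01)
import Literature.NumberTheory.Rogawski1990.CartanAlgebraTypesFinite           -- ★ (B7a-S) `exists_finset_cartanAlgebra_types_unitaryGroup` (F0P3a-p04 (g26); over ★ (B2) p851652 + ★ (B4) p851657)
import Literature.NumberTheory.LocalFields.FiniteSubextensions                   -- ★ `LocalField.finite_setOf_intermediateField_finrank_le` (Krasner finiteness at `L⁺_v`)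
import Literature.GroupTheory.CentralizerClassesTransport                       -- (B7b-pre) p851693 `exists_finset_centralizers_of_mulEquiv`, `isCompact_map_conj_iff` (this lineage, g24)
import Literature.NumberTheory.Rogawski1990.TypeThreeCubicTorusNonsplit         -- ★ p851001 `isRegularElt_iff_separable_localNonsplitEquiv` (one-place model; this lineage, g22)
import Literature.NumberTheory.LocalFields.QuadraticLocalNormFixedRange         -- ★ `galAdicCompletionMap_algebraMap_place`, `IsCMField.exists_algebraMap_place_eq`, `finrank` two
import Literature.NumberTheory.Rogawski1990.UnitaryVertexStabilizerCoverCM      -- ★ `galAdicCompletionMap_involutive`, `placeForm_map_transpose_of_hermitian`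
import Literature.NumberTheory.Automorphic.AdicCompletionLocalField             -- ★ `IsNonarchimedeanLocalField (v.adicCompletion K)`
import Summits.HodgeConjecture.HodgeConjecture.Theorems.F0P3cStCharTSEllCartanCompact   -- ★ p851477 (this lineage, g23): `isUnit_det_placeForm_qsForm` (+ compact∕non-compact Cartan split)
import Summits.HodgeConjecture.HodgeConjecture.Theorems.F0P3cStCharTSCharField          -- ★ p851211 `qsForm_map_cmConjRingHom_transpose`
import HarnessLib

/-!
# F0 · P3c · line LH6 «StCharTS» — «CARTAN-FIN (N1)★»: FINITELY MANY `U(Φ₃)(L⁺_v)`-CONJUGACY CLASSES OF CARTAN SUBGROUPS `Z(γ)` (`γ` regular), modulo the finiteness of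
# involutive Cartan-algebra TYPES; and the compact representatives `Sell` for the §12.5 datum [Rogawski1990 §3.6 p. 31; §12.5 p. 182]

Cell `pub/hodgecm-mathlib`, crux H413 = `stmt-HodgeConjecture-24833` (lane `--supports … --as helper`), route HCCMUnconditional; seat F0P3a-p03 (g24), road owner of the census-first
«CARTAN-FIN (N1)» road of the (S-𝔇) datum road (map owner LH6-p01 (g4); MAP v5 §3 row `cartanAll cartanG μT`: «RUNG0 HYPOTHESIS unless N1 lands»).  THEOREMS ONLY; ★-only imports + Mathlib.

WHAT.  `G = Gqs L v = U(Φ₃)(L⁺_v)` at a NON-SPLIT finite place `v` of `L⁺` (`w ∣ v`), Cartan subgroup = `Z_G(γ) = Subgroup.centralizer {γ}` for `γ` regular (`IsRegularElt`, separable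
characteristic polynomial).
* §1 the ONE-PLACE data at `(F, L_w, σ_w, Φ_w) = (L⁺_v, L_w, galAdicCompletionMap c, placeForm Φ₃ w)`: `σ_w` fixes `L⁺_v` and is an involution, `Fix(σ_w) = L⁺_v`, `2 ≠ 0`, `σ_w ≠ 1`,
  `Φ_w` invertible hermitian — the letters of ★ `UnitaryCartanClassesFinite` ∕ ★ `CartanAlgebraDescent` ∕ `CartanNormClassesFinite` (`onePlace_letters`).
* §2 **`exists_finset_cartanSubgroups_of_types`** — GIVEN the finiteness of involutive Cartan-algebra types in the one-place model (the hypothesis `hTypes` of ★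
  `exists_finset_cartanSubgroups_of_types_of_norms`, = brick (B7a-S) «STABLE-TYPES-FIN» of the road, F0P3a-p04 (g26)), there is a finite set `S` of Cartan subgroups of `G` such
  that EVERY Cartan subgroup `Z(γ)` is `u T u⁻¹`, `T ∈ S`: (NORMS) is discharged by `exists_finset_norm_classes` over the local field `L⁺_v`, the one-place theorem is ★ (B7a), and
  the transport to `G` runs along ★ `localNonsplitEquiv` (★ `isRegularElt_iff_separable_localNonsplitEquiv`, (B7b-pre) `exists_finset_centralizers_of_mulEquiv`).
* §3 **`exists_finset_compact_cartan_representatives_of_types`** — the COMPACT members: a finite `Sell` with `∀ T ∈ Sell, IsCompact T ∧ ∃ γ₀ regular, T = Z(γ₀)` (the RUNG0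
  hypothesis `hcartO`'s shape, rf f79bbe03 :105) such that every COMPACT Cartan subgroup is conjugate to a member of `Sell` — the `Sell` that RUNG0 v≥2 instantiates
  (`cartanAll := insert M Sell` per ★ p851537 `exists_normalised_cartan_family`; the non-compact Cartan subgroups are `Ad(G)·M`, ★ p851477).
* §4 **UNCONDITIONAL**: `hTypes` := ★ (B7a-S) `exists_finset_cartanAlgebra_types_unitaryGroup` (F0P3a-p04 (g26)) at the one-place letters with Krasner's finiteness ★
  `LocalField.finite_setOf_intermediateField_finrank_le` at `L⁺_v` — **`exists_finset_cartanSubgroups`** (finitely many conjugacy classes of Cartan subgroups of `U(Φ₃)(L⁺_v)`, `v`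
  non-split) and **`exists_finset_compact_cartan_representatives`** (the constructed `Sell` with `hcartO` ∧ completeness for the compact Cartan subgroups).
HONEST LABEL: HC_CM is proved only modulo the 7 printed citations (2 remaining named inputs hLiu418 = `stmt-HodgeConjecture-24832`, h413 = `stmt-HodgeConjecture-24833`) until rung 0
closes; this file closes no organ (count-neutral constructor-side asset of the (S-𝔇) datum road: it turns RUNG0's Cartan PARAMETER `Sell` into a constructed finite set).

## References
* [Rogawski1990] J. D. Rogawski, *Automorphic Representations of Unitary Groups in Three Variables*, Ann. of Math. Stud. 123 (1990): §3.6 pp. 28–31 (the Cartan subgroups of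
  `U(3)` over a local field: types (0)–(3), finitely many classes), §12.5 p. 182 («a set of representatives for the conjugacy classes of Cartan subgroups»).
* [PlatonovRapinchuk1994] V. Platonov, A. Rapinchuk, *Algebraic Groups and Number Theory* (1994), §6.4 Thm. 6.14 Cor. 1 (finitely many conjugacy classes of maximal tori over a
  local field of characteristic zero).
-/

set_option autoImplicit false
-- the mandated namespace has the single-problem summit's repeated segment (`HodgeConjecture.HodgeConjecture`)
set_option linter.dupNamespace false

noncomputable section

open NumberField IsDedekindDomain Polynomial
open scoped Matrix MatrixGroups
open Literature.NumberTheory.Rogawski1990 Literature.NumberTheory.Automorphic Literature.NumberTheory.Automorphic.UnitaryGroup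
open Literature.NumberTheory.GaloisRepresentations Literature.NumberTheory.LocalFields Literature.GroupTheory
open Literature.AlgebraicGeometry.ShimuraVarieties (unitaryGroup mem_unitaryGroup_iff)
open Literature.NumberTheory.Rogawski1990.TypeThreeTorus (isRegularElt_iff_separable_localNonsplitEquiv)
open Summit.HodgeConjecture.HodgeConjecture.Cruxes.H413.F0P3cStCharTSEllCartanCompact (isUnit_det_placeForm_qsForm)
open Summit.HodgeConjecture.HodgeConjecture.Cruxes.H413.F0P3cStCharTSCharField (qsForm_map_cmConjRingHom_transpose)

namespace Summit.HodgeConjecture.HodgeConjecture.Cruxes.H413.F0P3cStCharTSCartanFin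

/-! ## §1 The one-place letters -/

section OnePlace

variable (L : Type) [Field L] [NumberField L] [IsCMField L] {v : HeightOneSpectrum (𝓞 ↥(maximalRealSubfield L))}
  (w : PlacesOver L v) (hw : IsCMField.complexConj L • w.1 = w.1)

include hw in
/-- **The one-place letters** of ★ `UnitaryCartanClassesFinite` ∕ ★ `CartanAlgebraDescent` at `(L⁺_v, L_w, σ_w, Φ_w)`: `σ_w` fixes `L⁺_v`; `σ_w² = 1`; `Fix(σ_w) ⊆ L⁺_v`; `2 ≠ 0`; `σ_w ≠ 1`;
`det Φ_w` a unit; `Φ_w` is `σ_w`-hermitian. [cite: Rogawski1990, §3.6 p. 28; §1.9 p. 8] -/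
theorem onePlace_letters :
    (∀ q : v.adicCompletion ↥(maximalRealSubfield L), galAdicCompletionMap (L := L) (IsCMField.complexConj L) hw
        (algebraMap (v.adicCompletion ↥(maximalRealSubfield L)) (w.1.adicCompletion L) q) = algebraMap (v.adicCompletion ↥(maximalRealSubfield L)) (w.1.adicCompletion L) q) ∧
    (∀ x : w.1.adicCompletion L, galAdicCompletionMap (L := L) (IsCMField.complexConj L) hw (galAdicCompletionMap (L := L) (IsCMField.complexConj L) hw x) = x) ∧
    (∀ x : w.1.adicCompletion L, galAdicCompletionMap (L := L) (IsCMField.complexConj L) hw x = x →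
        ∃ q : v.adicCompletion ↥(maximalRealSubfield L), algebraMap (v.adicCompletion ↥(maximalRealSubfield L)) (w.1.adicCompletion L) q = x) ∧
    ((2 : w.1.adicCompletion L) ≠ 0) ∧
    (∃ ℓ : w.1.adicCompletion L, galAdicCompletionMap (L := L) (IsCMField.complexConj L) hw ℓ ≠ ℓ) ∧
    IsUnit (placeForm (qsForm L) w.1).det ∧
    ((placeForm (qsForm L) w.1).map (galAdicCompletionMap (L := L) (IsCMField.complexConj L) hw))ᵀ = placeForm (qsForm L) w.1 := by
  refine ⟨fun q => galAdicCompletionMap_algebraMap_place w (IsCMField.complexConj L) hw q, galAdicCompletionMap_involutive L v w hw,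
    fun x hx => IsCMField.exists_algebraMap_place_eq L w hw hx, two_ne_zero, ?_, isUnit_det_placeForm_qsForm L w,
    placeForm_map_transpose_of_hermitian L v w hw (qsForm L) (qsForm_map_cmConjRingHom_transpose L)⟩
  -- `σ_w ≠ 1`: complex conjugation moves some `x ∈ L`, and `L → L_w` is injective
  obtain ⟨x, hx⟩ := DFunLike.ne_iff.1 (IsCMField.complexConj_ne_one L)
  refine ⟨((x : L) : w.1.adicCompletion L), fun h => hx ?_⟩
  rw [galAdicCompletionMap_coe_algEquiv] at h
  exact (algebraMap L (w.1.adicCompletion L)).injective h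

end OnePlace

/-! ## §2 Finitely many conjugacy classes of Cartan subgroups of `U(Φ₃)(L⁺_v)`, given the finiteness of involutive Cartan-algebra types -/

section Main

variable (L : Type) [Field L] [NumberField L] [IsCMField L] (v : HeightOneSpectrum (𝓞 ↥(maximalRealSubfield L)))

/-- **«CARTAN-FIN (N1)★ modulo TYPES»** — at a non-split `v`: GIVEN, for a place `w ∣ v`, the finiteness of involutive Cartan-algebra types in the one-place model `U(σ_w, Φ_w)(L_w)` (the
hypothesis `hTypes` of ★ `exists_finset_cartanSubgroups_of_types_of_norms`, brick (B7a-S)), there is a FINITE set `S` of Cartan subgroups `Z(γ₀)` of `G = U(Φ₃)(L⁺_v)` such that the centraliser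
of EVERY regular `γ ∈ G` is `u T u⁻¹` with `T ∈ S`, `u ∈ G`. (NORMS) is discharged in-house (★ (B6) square classes over the local field `L⁺_v`); transport along ★ `localNonsplitEquiv`.
[cite: Rogawski1990, §3.6 p. 31; §12.5 p. 182] [cite: PlatonovRapinchuk1994, §6.4 Cor. 1] -/
theorem exists_finset_cartanSubgroups_of_types (w : PlacesOver L v) (hw : IsCMField.complexConj L • w.1 = w.1)
    (hTypes : ∃ Γ : Finset ↥(unitaryGroup (galAdicCompletionMap (L := L) (IsCMField.complexConj L) hw) (placeForm (qsForm L) w.1)),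
      ∀ (γ : ↥(unitaryGroup (galAdicCompletionMap (L := L) (IsCMField.complexConj L) hw) (placeForm (qsForm L) w.1)))
        (hreg : ((γ : GL (Fin 3) (w.1.adicCompletion L)) : Matrix (Fin 3) (Fin 3) (w.1.adicCompletion L)).charpoly.Separable),
        ∃ γ₀ ∈ Γ, ∃ hreg₀ : ((γ₀ : GL (Fin 3) (w.1.adicCompletion L)) : Matrix (Fin 3) (Fin 3) (w.1.adicCompletion L)).charpoly.Separable,
          ∃ Ψ : ↥(Algebra.adjoin (w.1.adicCompletion L) ({((γ₀ : GL (Fin 3) (w.1.adicCompletion L)) : Matrix (Fin 3) (Fin 3) (w.1.adicCompletion L))} : Set (Matrix (Fin 3) (Fin 3) (w.1.adicCompletion L)))) ≃ₐ[w.1.adicCompletion L]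
              ↥(Algebra.adjoin (w.1.adicCompletion L) ({((γ : GL (Fin 3) (w.1.adicCompletion L)) : Matrix (Fin 3) (Fin 3) (w.1.adicCompletion L))} : Set (Matrix (Fin 3) (Fin 3) (w.1.adicCompletion L)))),
            ∀ b, Ψ (cartanInvolution (F := v.adicCompletion ↥(maximalRealSubfield L)) (galAdicCompletionMap (L := L) (IsCMField.complexConj L) hw) (onePlace_letters L w hw).1
                (onePlace_letters L w hw).2.1 (onePlace_letters L w hw).2.2.2.2.2.1 (onePlace_letters L w hw).2.2.2.2.2.2 hreg₀ (mem_unitaryGroup_iff.1 γ₀.2) b) =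
              cartanInvolution (F := v.adicCompletion ↥(maximalRealSubfield L)) (galAdicCompletionMap (L := L) (IsCMField.complexConj L) hw) (onePlace_letters L w hw).1
                (onePlace_letters L w hw).2.1 (onePlace_letters L w hw).2.2.2.2.2.1 (onePlace_letters L w hw).2.2.2.2.2.2 hreg (mem_unitaryGroup_iff.1 γ.2) (Ψ b)) :
    ∃ S : Finset (Subgroup (Gqs L v)),
      (∀ T ∈ S, ∃ γ₀ : Gqs L v, IsRegularElt (γ₀.val : GL (Fin 3) (LocalRing L v)) ∧ T = Subgroup.centralizer ({γ₀} : Set (Gqs L v))) ∧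
      ∀ γ : Gqs L v, IsRegularElt (γ.val : GL (Fin 3) (LocalRing L v)) →
        ∃ T ∈ S, ∃ u : Gqs L v, Subgroup.centralizer ({γ} : Set (Gqs L v)) = T.map (MulAut.conj u).toMonoidHom := by
  obtain ⟨hσF, hσσ, hFix, h2, hex, hHdet, hH⟩ := onePlace_letters L w hw
  -- the one-place theorem: (TYPES) given, (NORMS) ★ over the local field `L⁺_v`
  have hone := exists_finset_cartanSubgroups_of_types_of_norms (F := v.adicCompletion ↥(maximalRealSubfield L))
    (galAdicCompletionMap (L := L) (IsCMField.complexConj L) hw) hσF hσσ hHdet hH hTypes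
    (fun γ₀ hreg₀ => exists_finset_norm_classes (F := v.adicCompletion ↥(maximalRealSubfield L))
      (galAdicCompletionMap (L := L) (IsCMField.complexConj L) hw) hσF hσσ hHdet hH γ₀ hreg₀)
  -- transport along the one-place model `e : G ≃* U(σ_w, Φ_w)(L_w)`
  let e₁ := localNonsplitEquiv (IsCMField.complexConj L) (qsForm L) (IsCMField.complexConj_ne_one L) w hw
  have hUU : unitaryGroupOfForm (galAdicCompletionMap (L := L) (IsCMField.complexConj L) hw) (placeForm (qsForm L) w.1) =
      unitaryGroup (galAdicCompletionMap (L := L) (IsCMField.complexConj L) hw) (placeForm (qsForm L) w.1) := Subgroup.ext fun _ => Iff.rfl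
  let e : Gqs L v ≃* ↥(unitaryGroup (galAdicCompletionMap (L := L) (IsCMField.complexConj L) hw) (placeForm (qsForm L) w.1)) :=
    e₁.toMulEquiv.trans (MulEquiv.subgroupCongr hUU)
  refine exists_finset_centralizers_of_mulEquiv e (P := fun γ : Gqs L v => IsRegularElt (γ.val : GL (Fin 3) (LocalRing L v)))
    (P' := fun γ' => ((γ' : GL (Fin 3) (w.1.adicCompletion L)) : Matrix (Fin 3) (Fin 3) (w.1.adicCompletion L)).charpoly.Separable) (fun γ => ?_) hone
  exact isRegularElt_iff_separable_localNonsplitEquiv L w hw γ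

/-! ## §3 The compact representatives `Sell` (RUNG0's `hcartO` shape) -/

/-- **The compact Cartan representatives**, given (TYPES): a finite `Sell` of COMPACT centralisers `Z(γ₀)` (`γ₀` regular) such that every COMPACT Cartan subgroup of `U(Φ₃)(L⁺_v)` is
`u T u⁻¹` with `T ∈ Sell` (the shape of the RUNG0 hypothesis `hcartO`; `cartanAll := insert M Sell` by ★ `exists_normalised_cartan_family`, the non-compact ones being `Ad(G)·M`, ★
`exists_conj_cmTorus_of_not_isCompact_centralizer`). [cite: Rogawski1990, §3.6 p. 31; §12.5 pp. 182, 184] -/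
theorem exists_finset_compact_cartan_representatives_of_types (w : PlacesOver L v) (hw : IsCMField.complexConj L • w.1 = w.1)
    (hTypes : ∃ Γ : Finset ↥(unitaryGroup (galAdicCompletionMap (L := L) (IsCMField.complexConj L) hw) (placeForm (qsForm L) w.1)),
      ∀ (γ : ↥(unitaryGroup (galAdicCompletionMap (L := L) (IsCMField.complexConj L) hw) (placeForm (qsForm L) w.1)))
        (hreg : ((γ : GL (Fin 3) (w.1.adicCompletion L)) : Matrix (Fin 3) (Fin 3) (w.1.adicCompletion L)).charpoly.Separable),
        ∃ γ₀ ∈ Γ, ∃ hreg₀ : ((γ₀ : GL (Fin 3) (w.1.adicCompletion L)) : Matrix (Fin 3) (Fin 3) (w.1.adicCompletion L)).charpoly.Separable,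
          ∃ Ψ : ↥(Algebra.adjoin (w.1.adicCompletion L) ({((γ₀ : GL (Fin 3) (w.1.adicCompletion L)) : Matrix (Fin 3) (Fin 3) (w.1.adicCompletion L))} : Set (Matrix (Fin 3) (Fin 3) (w.1.adicCompletion L)))) ≃ₐ[w.1.adicCompletion L]
              ↥(Algebra.adjoin (w.1.adicCompletion L) ({((γ : GL (Fin 3) (w.1.adicCompletion L)) : Matrix (Fin 3) (Fin 3) (w.1.adicCompletion L))} : Set (Matrix (Fin 3) (Fin 3) (w.1.adicCompletion L)))),
            ∀ b, Ψ (cartanInvolution (F := v.adicCompletion ↥(maximalRealSubfield L)) (galAdicCompletionMap (L := L) (IsCMField.complexConj L) hw) (onePlace_letters L w hw).1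
                (onePlace_letters L w hw).2.1 (onePlace_letters L w hw).2.2.2.2.2.1 (onePlace_letters L w hw).2.2.2.2.2.2 hreg₀ (mem_unitaryGroup_iff.1 γ₀.2) b) =
              cartanInvolution (F := v.adicCompletion ↥(maximalRealSubfield L)) (galAdicCompletionMap (L := L) (IsCMField.complexConj L) hw) (onePlace_letters L w hw).1
                (onePlace_letters L w hw).2.1 (onePlace_letters L w hw).2.2.2.2.2.1 (onePlace_letters L w hw).2.2.2.2.2.2 hreg (mem_unitaryGroup_iff.1 γ.2) (Ψ b)) :
    ∃ Sell : Finset (Subgroup (Gqs L v)),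
      (∀ T ∈ Sell, IsCompact (T : Set (Gqs L v)) ∧ ∃ γ₀ : Gqs L v, IsRegularElt (γ₀.val : GL (Fin 3) (LocalRing L v)) ∧ T = Subgroup.centralizer ({γ₀} : Set (Gqs L v))) ∧
      ∀ γ : Gqs L v, IsRegularElt (γ.val : GL (Fin 3) (LocalRing L v)) → IsCompact ((Subgroup.centralizer ({γ} : Set (Gqs L v))) : Set (Gqs L v)) →
        ∃ T ∈ Sell, ∃ u : Gqs L v, Subgroup.centralizer ({γ} : Set (Gqs L v)) = T.map (MulAut.conj u).toMonoidHom := by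
  classical
  obtain ⟨S, hS, hcov⟩ := exists_finset_cartanSubgroups_of_types L v w hw hTypes
  refine ⟨S.filter (fun T => IsCompact (T : Set (Gqs L v))), fun T hT => ?_, fun γ hreg hcpt => ?_⟩
  · rw [Finset.mem_filter] at hT
    exact ⟨hT.2, hS T hT.1⟩
  · obtain ⟨T, hTS, u, hu⟩ := hcov γ hreg
    refine ⟨T, Finset.mem_filter.2 ⟨hTS, ?_⟩, u, hu⟩
    rw [← isCompact_map_conj_iff T u, ← hu]
    exact hcpt

/-! ## §4 Unconditional: (TYPES) is ★ (B7a-S) -/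

/-- **(TYPES) at the one-place model** — ★ (B7a-S) `exists_finset_cartanAlgebra_types_unitaryGroup` (finitely many involutive Cartan-algebra types, from ★ (B2) finitely many étale
`L⁺_v`-algebras of bounded degree (Krasner) and ★ (B4) descent) instantiated at the one-place letters. [cite: Rogawski1990, §3.6 p. 31] [cite: PlatonovRapinchuk1994, §6.4 Cor. 1] -/
theorem cartanAlgebra_types_onePlace (w : PlacesOver L v) (hw : IsCMField.complexConj L • w.1 = w.1) :
    ∃ Γ : Finset ↥(unitaryGroup (galAdicCompletionMap (L := L) (IsCMField.complexConj L) hw) (placeForm (qsForm L) w.1)),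
      ∀ (γ : ↥(unitaryGroup (galAdicCompletionMap (L := L) (IsCMField.complexConj L) hw) (placeForm (qsForm L) w.1)))
        (hreg : ((γ : GL (Fin 3) (w.1.adicCompletion L)) : Matrix (Fin 3) (Fin 3) (w.1.adicCompletion L)).charpoly.Separable),
        ∃ γ₀ ∈ Γ, ∃ hreg₀ : ((γ₀ : GL (Fin 3) (w.1.adicCompletion L)) : Matrix (Fin 3) (Fin 3) (w.1.adicCompletion L)).charpoly.Separable,
          ∃ Ψ : ↥(Algebra.adjoin (w.1.adicCompletion L) ({((γ₀ : GL (Fin 3) (w.1.adicCompletion L)) : Matrix (Fin 3) (Fin 3) (w.1.adicCompletion L))} : Set (Matrix (Fin 3) (Fin 3) (w.1.adicCompletion L)))) ≃ₐ[w.1.adicCompletion L]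
              ↥(Algebra.adjoin (w.1.adicCompletion L) ({((γ : GL (Fin 3) (w.1.adicCompletion L)) : Matrix (Fin 3) (Fin 3) (w.1.adicCompletion L))} : Set (Matrix (Fin 3) (Fin 3) (w.1.adicCompletion L)))),
            ∀ b, Ψ (cartanInvolution (F := v.adicCompletion ↥(maximalRealSubfield L)) (galAdicCompletionMap (L := L) (IsCMField.complexConj L) hw) (onePlace_letters L w hw).1
                (onePlace_letters L w hw).2.1 (onePlace_letters L w hw).2.2.2.2.2.1 (onePlace_letters L w hw).2.2.2.2.2.2 hreg₀ (mem_unitaryGroup_iff.1 γ₀.2) b) =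
              cartanInvolution (F := v.adicCompletion ↥(maximalRealSubfield L)) (galAdicCompletionMap (L := L) (IsCMField.complexConj L) hw) (onePlace_letters L w hw).1
                (onePlace_letters L w hw).2.1 (onePlace_letters L w hw).2.2.2.2.2.1 (onePlace_letters L w hw).2.2.2.2.2.2 hreg (mem_unitaryGroup_iff.1 γ.2) (Ψ b) :=
  exists_finset_cartanAlgebra_types_unitaryGroup (F := v.adicCompletion ↥(maximalRealSubfield L)) (galAdicCompletionMap (L := L) (IsCMField.complexConj L) hw)
    (onePlace_letters L w hw).1 (onePlace_letters L w hw).2.1 (onePlace_letters L w hw).2.2.1 (onePlace_letters L w hw).2.2.2.1 (onePlace_letters L w hw).2.2.2.2.1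
    (onePlace_letters L w hw).2.2.2.2.2.1 (onePlace_letters L w hw).2.2.2.2.2.2 (LocalField.finite_setOf_intermediateField_finrank_le (v.adicCompletion ↥(maximalRealSubfield L)))

/-- **«CARTAN-FIN (N1)★» — FINITELY MANY CONJUGACY CLASSES OF CARTAN SUBGROUPS of `U(Φ₃)(L⁺_v)`** (`v` a finite place of `L⁺` non-split in the CM field `L`): a finite set `S` of
centralisers `Z(γ₀)` of regular elements such that the centraliser of EVERY regular `γ` is `u T u⁻¹` with `T ∈ S`, `u ∈ U(Φ₃)(L⁺_v)`.  In-house (Mathlib-footed) replacement of the cited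
[PlatonovRapinchuk1994 §6.4] input of the (S-𝔇) datum road (MAP v5 §2∕§3: N1). [cite: Rogawski1990, §3.6 p. 31; §12.5 p. 182] [cite: PlatonovRapinchuk1994, §6.4 Cor. 1] -/
theorem exists_finset_cartanSubgroups (hns : ∀ w : PlacesOver L v, IsCMField.complexConj L • w.1 = w.1) :
    ∃ S : Finset (Subgroup (Gqs L v)),
      (∀ T ∈ S, ∃ γ₀ : Gqs L v, IsRegularElt (γ₀.val : GL (Fin 3) (LocalRing L v)) ∧ T = Subgroup.centralizer ({γ₀} : Set (Gqs L v))) ∧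
      ∀ γ : Gqs L v, IsRegularElt (γ.val : GL (Fin 3) (LocalRing L v)) →
        ∃ T ∈ S, ∃ u : Gqs L v, Subgroup.centralizer ({γ} : Set (Gqs L v)) = T.map (MulAut.conj u).toMonoidHom := by
  obtain ⟨w⟩ := (inferInstance : Nonempty (PlacesOver L v))
  exact exists_finset_cartanSubgroups_of_types L v w (hns w) (cartanAlgebra_types_onePlace L v w (hns w))

/-- **The compact Cartan representatives `Sell` for the §12.5 datum — UNCONDITIONAL**: a finite set of COMPACT centralisers `Z(γ₀)` (`γ₀` regular) of `U(Φ₃)(L⁺_v)` such that every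
COMPACT Cartan subgroup is `u T u⁻¹` with `T ∈ Sell` (RUNG0's `hcartO` shape + completeness; `cartanAll := insert M Sell`, ★ `exists_normalised_cartan_family`, the non-compact Cartan
subgroups being `Ad(G)·M`, ★ `exists_conj_cmTorus_of_not_isCompact_centralizer`). [cite: Rogawski1990, §3.6 p. 31; §12.5 pp. 182, 184] [cite: PlatonovRapinchuk1994, §6.4 Cor. 1] -/
theorem exists_finset_compact_cartan_representatives (hns : ∀ w : PlacesOver L v, IsCMField.complexConj L • w.1 = w.1) :
    ∃ Sell : Finset (Subgroup (Gqs L v)),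
      (∀ T ∈ Sell, IsCompact (T : Set (Gqs L v)) ∧ ∃ γ₀ : Gqs L v, IsRegularElt (γ₀.val : GL (Fin 3) (LocalRing L v)) ∧ T = Subgroup.centralizer ({γ₀} : Set (Gqs L v))) ∧
      ∀ γ : Gqs L v, IsRegularElt (γ.val : GL (Fin 3) (LocalRing L v)) → IsCompact ((Subgroup.centralizer ({γ} : Set (Gqs L v))) : Set (Gqs L v)) →
        ∃ T ∈ Sell, ∃ u : Gqs L v, Subgroup.centralizer ({γ} : Set (Gqs L v)) = T.map (MulAut.conj u).toMonoidHom := by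
  obtain ⟨w⟩ := (inferInstance : Nonempty (PlacesOver L v))
  exact exists_finset_compact_cartan_representatives_of_types L v w (hns w) (cartanAlgebra_types_onePlace L v w (hns w))

end Main

end Summit.HodgeConjecture.HodgeConjecture.Cruxes.H413.F0P3cStCharTSCartanFin

end
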